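import Mathlib
import HarnessLib
import Summits.Ventures.LatticeQCDFlow.Scoring.TranslationAverageTwoPoint
import Summits.Ventures.LatticeQCDFlow.Scoring.HMCKernelSymmetry

/-!
# The charge–energy cross two-point function along the HMC run is odd under the time mirror — and vanishes at equal times

HONEST FRAMING: exact (Metropolis-corrected) sampling algorithms for lattice gauge theory;
figures of merit are autocorrelation/cost numbers at stated couplings and volumes; no
continuum-physics claim.

Venture `LatticeQCDFlow` (cell pub-lqcd), topic `Scoring`, FANOUT row 21 (`su3-base`, arm E2 records the flowed charge
density `q_x = P_x ∘ RK3_{ε'}^m` and the flowed energy density `E_x = E_x ∘ RK3_{ε'}^m` per site / per slice).  NEW WORK of the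
cell, a companion of row 21's `HMCFlowedChargeDensity` (one-point: `E_N[q_x] = 0`) and `FlowedEnergyLatticeSymmetry`
(`E_N[Q · ΣE] = 0`): the MIXED two-point function.  Under the time reflection `Θ'` the charge density is odd and the energy
density even (`q_x(Θ'U) = −q_{θ'x}(U)`, `E_x(Θ'U) = E_{θ'x}(U)`), so under every `Θ'`-invariant law
`E[q_x E_y] = −E[q_{θ'x} E_{θ'y}]`; with translation invariance the cross two-point function depends on `y − x` only, and
`θ'y − θ'x = y − x` whenever `x₀ = y₀` — hence **the equal-time charge–energy cross-correlator vanishes identically**, at every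
HMC step from the cold or the hot start.  Def-free; nothing is cited as a fact; no number.

* §1 `rk3CloverDensity_negReflect` (every site), `negReflect_sub_negReflect_of_apply_zero_eq`.
* §2 `integral_rk3CloverDensity_mul_energy_negReflect` (any `Θ'`-invariant law: `E[q_x E_y] = −E[q_{θ'x} E_{θ'y}]`),
  **`integral_rk3CloverDensity_mul_energy_eq_zero_of_apply_zero_eq`** (any `Θ'`- and translation-invariant law, `x₀ = y₀`:
  `E[q_x E_y] = 0`).
* §3 along the run: **`integral_hmcChain_rk3CloverDensity_mul_energy_eq_zero`** (every step `N`, every start invariant under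
  `Θ'` and all translations), cold / hot corollaries.
NOT CLAIMED: unequal times (only the mirror antisymmetry); arm E1; numbers.
-/

noncomputable section

open MeasureTheory ProbabilityTheory
open Literature.MathematicalPhysics.QuantumFieldTheory
open Literature.MathematicalPhysics.QuantumFieldTheory.Luscher2010 (SuBasis)
open Literature.MathematicalPhysics.QuantumLattice (fundamentalRep cloverPseudoscalar flowedCloverEnergy
  fundamentalRep_mem_unitaryGroup)
open Summit.Ventures.LatticeQCDFlow.Exactness (nHit isMarkovKernel_nHit)

namespace Summit.Ventures.LatticeQCDFlow.Scoring

/-! ## §1 Pointwise: the charge density is `Θ'`-odd at every site; mirrored equal-time pairs keep their separation -/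

section Pointwise

variable {L n : ℕ} [NeZero L]

omit [NeZero L] in
/-- **`q_x(RK3^m(Θ'U)) = −q_{θ'x}(RK3^m U)`** at every site. -/
theorem rk3CloverDensity_negReflect (ε' : ℝ) (m : ℕ) (x : Site 4 L) (U : GaugeConfig 4 L (Matrix.specialUnitaryGroup (Fin n) ℂ)) :
    cloverPseudoscalar (fundamentalRep (Fin n)) x ((wilsonFlowRK3 ε')^[m] U.negReflect) =
      -cloverPseudoscalar (fundamentalRep (Fin n)) x.negReflect ((wilsonFlowRK3 ε')^[m] U) := by
  rw [iterate_wilsonFlowRK3_negReflect, cloverPseudoscalar_negReflect _ fundamentalRep_mem_unitaryGroup]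

omit [NeZero L] in
/-- Equal-time pairs keep their separation under the time mirror: `x₀ = y₀ ⇒ θ'y − θ'x = y − x`. -/
theorem negReflect_sub_negReflect_of_apply_zero_eq {d : ℕ} [NeZero d] {x y : Site d L} (h : x 0 = y 0) :
    y.negReflect - x.negReflect = y - x := by
  funext k
  by_cases hk : k = 0
  · subst hk
    rw [Pi.sub_apply, Pi.sub_apply, WilsonSiteRP.negReflect_apply_zero, WilsonSiteRP.negReflect_apply_zero, h, sub_self,
      sub_self]
  · rw [Pi.sub_apply, Pi.sub_apply, WilsonSiteRP.negReflect_apply_of_ne _ hk, WilsonSiteRP.negReflect_apply_of_ne _ hk]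

end Pointwise

/-! ## §2 Under a `Θ'`-invariant (and translation-invariant) law -/

section Law

variable {L n : ℕ} {μ : Measure (GaugeConfig 4 L (Matrix.specialUnitaryGroup (Fin n) ℂ))}

/-- **`E[q_x E_y] = −E[q_{θ'x} E_{θ'y}]`** under every `Θ'`-invariant law (no integrability needed). -/
theorem integral_rk3CloverDensity_mul_energy_negReflect (hR : μ.map GaugeConfig.negReflect = μ) (ε' : ℝ) (m : ℕ)
    (x y : Site 4 L) :
    ∫ U, cloverPseudoscalar (fundamentalRep (Fin n)) x ((wilsonFlowRK3 ε')^[m] U) *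
        flowedCloverEnergy (fundamentalRep (Fin n)) 0 y ((wilsonFlowRK3 ε')^[m] U) ∂μ =
      -∫ U, cloverPseudoscalar (fundamentalRep (Fin n)) x.negReflect ((wilsonFlowRK3 ε')^[m] U) *
        flowedCloverEnergy (fundamentalRep (Fin n)) 0 y.negReflect ((wilsonFlowRK3 ε')^[m] U) ∂μ := by
  have hmp : MeasurePreserving GaugeConfig.negReflect μ μ := ⟨WilsonSiteRP.negReflectEquiv.measurable, hR⟩
  have h := hmp.integral_comp WilsonSiteRP.negReflectEquiv.measurableEmbedding
    (fun U => cloverPseudoscalar (fundamentalRep (Fin n)) x ((wilsonFlowRK3 ε')^[m] U) *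
      flowedCloverEnergy (fundamentalRep (Fin n)) 0 y ((wilsonFlowRK3 ε')^[m] U))
  rw [← h, ← integral_neg]
  refine integral_congr_ae (ae_of_all _ fun U => ?_)
  show cloverPseudoscalar (fundamentalRep (Fin n)) x ((wilsonFlowRK3 ε')^[m] U.negReflect) *
      flowedCloverEnergy (fundamentalRep (Fin n)) 0 y ((wilsonFlowRK3 ε')^[m] U.negReflect) = _
  rw [rk3CloverDensity_negReflect, rk3CloverEnergy_negReflect, neg_mul]

/-- **THE EQUAL-TIME CHARGE–ENERGY CROSS-CORRELATOR VANISHES**: under every law invariant under `Θ'` and all translations,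
`E[q_x E_y] = 0` whenever `x₀ = y₀`. -/
theorem integral_rk3CloverDensity_mul_energy_eq_zero_of_apply_zero_eq (hR : μ.map GaugeConfig.negReflect = μ)
    (hT : ∀ v : Site 4 L, μ.map (TorusTranslation.torusConfigShift v) = μ) (ε' : ℝ) (m : ℕ) {x y : Site 4 L} (hxy : x 0 = y 0) :
    ∫ U, cloverPseudoscalar (fundamentalRep (Fin n)) x ((wilsonFlowRK3 ε')^[m] U) *
        flowedCloverEnergy (fundamentalRep (Fin n)) 0 y ((wilsonFlowRK3 ε')^[m] U) ∂μ = 0 := by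
  have hsep : ∀ a b : Site 4 L,
      ∫ U, cloverPseudoscalar (fundamentalRep (Fin n)) a ((wilsonFlowRK3 ε')^[m] U) *
          flowedCloverEnergy (fundamentalRep (Fin n)) 0 b ((wilsonFlowRK3 ε')^[m] U) ∂μ =
        ∫ U, cloverPseudoscalar (fundamentalRep (Fin n)) 0 ((wilsonFlowRK3 ε')^[m] U) *
          flowedCloverEnergy (fundamentalRep (Fin n)) 0 (b - a) ((wilsonFlowRK3 ε')^[m] U) ∂μ := fun a b =>
    integral_siteField_mul_translate hT (fun x U => cloverPseudoscalar (fundamentalRep (Fin n)) x ((wilsonFlowRK3 ε')^[m] U))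
      (fun x U => flowedCloverEnergy (fundamentalRep (Fin n)) 0 x ((wilsonFlowRK3 ε')^[m] U))
      (fun v x U => rk3CloverDensity_torusConfigShift ε' m v x U) (fun v x U => rk3CloverEnergy_torusConfigShift ε' m v x U) a b
  have h1 := integral_rk3CloverDensity_mul_energy_negReflect hR ε' m x y
  rw [hsep x y] at h1 ⊢
  rw [hsep x.negReflect y.negReflect, negReflect_sub_negReflect_of_apply_zero_eq hxy] at h1
  linarith

end Law

/-! ## §3 Along the HMC run -/

section Run

variable {L n : ℕ} [NeZero L] (B : SuBasis n) (β ε : ℝ) (w : List MDOp)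

/-- **AT EVERY HMC STEP `E_N[q_x E_y] = 0` FOR EQUAL-TIME PAIRS** (`x₀ = y₀`), from any start invariant under `Θ'` and all
translations. -/
theorem integral_hmcChain_rk3CloverDensity_mul_energy_eq_zero
    {μ₀ : Measure (GaugeConfig 4 L (Matrix.specialUnitaryGroup (Fin n) ℂ))} (hR : μ₀.map GaugeConfig.negReflect = μ₀)
    (hT : ∀ v : Site 4 L, μ₀.map (TorusTranslation.torusConfigShift v) = μ₀) (N : ℕ) (ε' : ℝ) (m : ℕ) {x y : Site 4 L}
    (hxy : x 0 = y 0) :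
    ∫ U, cloverPseudoscalar (fundamentalRep (Fin n)) x ((wilsonFlowRK3 ε')^[m] U) *
        flowedCloverEnergy (fundamentalRep (Fin n)) 0 y ((wilsonFlowRK3 ε')^[m] U) ∂(μ₀.bind (nHit (hmcKernel B β ε w) N)) = 0 :=
  integral_rk3CloverDensity_mul_energy_eq_zero_of_apply_zero_eq (map_bind_nHit_eq_self (conjKernel_hmcKernel B β ε w) hR N)
    (hmcChain_law_map_torusConfigShift B β ε w · (hT _) N) ε' m hxy

/-- **The mirror antisymmetry along the run**: `E_N[q_x E_y] = −E_N[q_{θ'x} E_{θ'y}]` at every step from any `Θ'`-invariant start. -/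
theorem integral_hmcChain_rk3CloverDensity_mul_energy_negReflect
    {μ₀ : Measure (GaugeConfig 4 L (Matrix.specialUnitaryGroup (Fin n) ℂ))} (hR : μ₀.map GaugeConfig.negReflect = μ₀)
    (N : ℕ) (ε' : ℝ) (m : ℕ) (x y : Site 4 L) :
    ∫ U, cloverPseudoscalar (fundamentalRep (Fin n)) x ((wilsonFlowRK3 ε')^[m] U) *
        flowedCloverEnergy (fundamentalRep (Fin n)) 0 y ((wilsonFlowRK3 ε')^[m] U) ∂(μ₀.bind (nHit (hmcKernel B β ε w) N)) =
      -∫ U, cloverPseudoscalar (fundamentalRep (Fin n)) x.negReflect ((wilsonFlowRK3 ε')^[m] U) *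
        flowedCloverEnergy (fundamentalRep (Fin n)) 0 y.negReflect ((wilsonFlowRK3 ε')^[m] U)
        ∂(μ₀.bind (nHit (hmcKernel B β ε w) N)) :=
  integral_rk3CloverDensity_mul_energy_negReflect (map_bind_nHit_eq_self (conjKernel_hmcKernel B β ε w) hR N) ε' m x y

/-- Cold start (`U ≡ 1`): `E_N[q_x E_y] = 0` for equal-time pairs at every step. -/
theorem integral_hmcColdStart_rk3CloverDensity_mul_energy_eq_zero (N : ℕ) (ε' : ℝ) (m : ℕ) {x y : Site 4 L} (hxy : x 0 = y 0) :
    ∫ U, cloverPseudoscalar (fundamentalRep (Fin n)) x ((wilsonFlowRK3 ε')^[m] U) *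
        flowedCloverEnergy (fundamentalRep (Fin n)) 0 y ((wilsonFlowRK3 ε')^[m] U)
        ∂((Measure.dirac (1 : GaugeConfig 4 L (Matrix.specialUnitaryGroup (Fin n) ℂ))).bind (nHit (hmcKernel B β ε w) N)) = 0 :=
  integral_hmcChain_rk3CloverDensity_mul_energy_eq_zero B β ε w dirac_one_map_negReflect dirac_one_map_torusConfigShift N ε' m hxy

/-- Hot start (`∏ dHaar`): `E_N[q_x E_y] = 0` for equal-time pairs at every step. -/
theorem integral_hmcHotStart_rk3CloverDensity_mul_energy_eq_zero (N : ℕ) (ε' : ℝ) (m : ℕ) {x y : Site 4 L} (hxy : x 0 = y 0) :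
    ∫ U, cloverPseudoscalar (fundamentalRep (Fin n)) x ((wilsonFlowRK3 ε')^[m] U) *
        flowedCloverEnergy (fundamentalRep (Fin n)) 0 y ((wilsonFlowRK3 ε')^[m] U)
        ∂((Measure.pi fun _ : Edge 4 L => haarProbability (Matrix.specialUnitaryGroup (Fin n) ℂ)).bind
          (nHit (hmcKernel B β ε w) N)) = 0 :=
  integral_hmcChain_rk3CloverDensity_mul_energy_eq_zero B β ε w piHaar_map_negReflect piHaar_map_torusConfigShift N ε' m hxy

end Run

end Summit.Ventures.LatticeQCDFlow.Scoring
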